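import Literature.MathematicalPhysics.QuantumLattice.PeriodicCellEnergyMinimisers
import HarnessLib

/-!
# The variational cell energy is CONVEX in the cell filling; supporting chemical potentials exist at interior fillings;
# the planes of an inequivalent-plane crystal share ONE chemical potential

Topic `Literature/MathematicalPhysics/QuantumLattice` (namespace = path; family `hubbard`). Sequel of `SuperlatticeCellEnergyFamilies`
(cell energies of views over periodic classes), `PeriodicCellEnergyMinimisers` and `InequivalentLayerStackingTransport` (§5: at a
SUPPORTING chemical potential of the crystal's energy–filling curve the canonical doping-split brackets carry no slack). Here the
supporting chemical potential is PRODUCED: mixtures of periodic states are periodic, cell energy and cell filling are affine, so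
`ρ̄ ↦ inf_{periodic, cell filling ρ̄} e` is convex on the (convex) set of realised cell fillings (Ruelle 1969 §3.4), and a convex
function has a supporting line at every interior point (its right derivative; Rockafellar 1970 Thm. 23.4 / 24.1).

* §1 `IsPeriodic.mix`, `cellEnergy_mix`, `cellFilling_mix`; the set of realised cell fillings is convex
  (`convex_setOf_periodicStatesAt_nonempty`); **`infCellEnergyOn_periodicStatesAt_convex_comb_le`** (three-point form) and
  **`convexOn_infCellEnergyOn_periodicStatesAt`**.
* §2 **`exists_supporting_slope_infCellEnergyOn_periodicStatesAt`**: at every interior realised filling `ρ̄` there is `μ` with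
  `inf_{ρ̄} e + μ (ρ' − ρ̄) ≤ inf_{ρ'} e` for every realised `ρ'` — a CHEMICAL POTENTIAL of the superlattice model at `ρ̄`.
* §3 the inequivalent-plane crystal: realised cell fillings contain every mean of realised plane densities
  (`periodicStatesAt_stackPeriods_nonempty_of_forall`), hence `(0,2) ⊆ interior` on `ℤ³` (`Ioo_subset_interior_…` for `d = 2`);
  **`IsPeriodic.exists_common_chemicalPotential`** — ELECTROCHEMICAL EQUILIBRIUM BETWEEN THE PLANES: for every periodic `ω`
  within `δ` of the infimum at its own interior cell filling there is ONE `μ` (a chemical potential of the crystal) such that EVERY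
  plane marginal `σ_j` is a near grand-canonical ground state of ITS OWN plane model at `μ − ε_j`, with excess
  `≤ (p+1)δ + 2Σ|tz|` and NO further slack; **`IsPeriodic.exists_common_chemicalPotential_layerDensity_brackets`** — the
  doping-split brackets at that common `μ`.

Everything is PROVED; no definition, no named fact, no number. HONEST SCOPE: the common `μ` is produced non-constructively (a
right derivative); to evaluate the brackets a consumer bounds `μ` by secants of the crystal's certified energy words (the
bracket functions are monotone in `μ`) — not done here.

## Tree / Mathlib search

REUSED: `mix`, `shift_mix`, `meanEnergy_mix`, `density_mix`, `IsTranslationInvariant.mix`; `cellEnergy`, `cellFilling_eq_density_cellAverage`,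
`density_shiftAverage`, `infCellEnergyOn(_le_cellEnergy)`, `le_infCellEnergyOn`, `exists_cellEnergy_lt_of_infCellEnergyOn_lt`,
`periodicStatesAt` (`SuperlatticeCellEnergyFamilies`); `planeStack_mem_periodicStatesAt`, `exists_isTranslationInvariant_density_eq`;
`infCellEnergyOn_sub_mu_sub_gc_le_zero_of_supporting`, `IsPeriodic.meanEnergy_layerMarginal_gc_le_of_budget`,
`IsPeriodic.gc_budget_of_nearMin`, `IsPeriodic.layerDensity_brackets_of_supporting` (`InequivalentLayerStackingTransport`); Mathlib
`ConvexOn.rightDeriv_le_slope_of_mem_interior`, `ConvexOn.slope_le_leftDeriv_of_mem_interior`,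
`ConvexOn.leftDeriv_le_rightDeriv_of_mem_interior`, `interior_mono`, `interior_Ioo`. Pattern of `exists_supporting_line_energyDensityTT'`.

## References

* D. Ruelle, *Statistical Mechanics: Rigorous Results* (1969), §3.4 (convexity of the energy density in the particle density;
  chemical potential as a tangent slope). [cite: Ruelle1969, §3.4]
* R. T. Rockafellar, *Convex Analysis* (1970), Thm. 23.4 / Thm. 24.1 (subgradients of convex functions on the line; one-sided
  derivatives). [cite: Rockafellar1970, Thm 24.1]
* O. Bratteli, D. W. Robinson, *OAQSM 1* (1987), §4.3.1 (convex combinations of states). [cite: BratteliRobinsonI1987, §4.3.1]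
* H. Mukuda et al., J. Phys. Soc. Jpn. 81 (2012) 011008, §2 (charge distribution between inequivalent planes). [cite: MukudaEtAl2012, §2]
-/

noncomputable section

namespace Literature.MathematicalPhysics.QuantumLattice

open Matrix Finset HubbardWave0 Literature.Probability.LatticeModels ThermodynamicLimit
open scoped ComplexOrder BigOperators

variable {d : ℕ} {q : Fin d → ℕ}

/-! ### §1. Mixtures of periodic states; convexity in the cell filling -/

namespace InfVolFermionState

/-- A mixture of `q`-periodic states is `q`-periodic. [cite: BratteliRobinsonI1987, §4.3.1] -/
theorem IsPeriodic.mix {ω₁ ω₂ : InfVolFermionState d} (h₁ : ω₁.IsPeriodic q) (h₂ : ω₂.IsPeriodic q) (t : ℝ)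
    (ht₀ : 0 ≤ t) (ht₁ : t ≤ 1) : (InfVolFermionState.mix t ht₀ ht₁ ω₁ ω₂).IsPeriodic q := fun i => by
  rw [shift_mix, h₁ i, h₂ i]

/-- **The cell energy is affine**: `e_M(tω₁ + (1−t)ω₂) = t e_M(ω₁) + (1−t) e_M(ω₂)`.
[cite: BratteliRobinsonI1987, §4.3.1] -/
theorem cellEnergy_mix (M : Cell q → FermionInteraction d) (R t : ℝ) (ht₀ : 0 ≤ t) (ht₁ : t ≤ 1)
    (ω₁ ω₂ : InfVolFermionState d) :
    (InfVolFermionState.mix t ht₀ ht₁ ω₁ ω₂).cellEnergy M R = t * ω₁.cellEnergy M R + (1 - t) * ω₂.cellEnergy M R := by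
  simp only [InfVolFermionState.cellEnergy, shift_mix, meanEnergy_mix, Finset.sum_add_distrib, ← Finset.mul_sum]
  ring

/-- **The cell filling is affine.** [cite: BratteliRobinsonI1987, §4.3.1] -/
theorem cellFilling_mix (t : ℝ) (ht₀ : 0 ≤ t) (ht₁ : t ≤ 1) (ω₁ ω₂ : InfVolFermionState d) :
    (InfVolFermionState.mix t ht₀ ht₁ ω₁ ω₂).cellFilling q = t * ω₁.cellFilling q + (1 - t) * ω₂.cellFilling q := by
  simp only [InfVolFermionState.cellFilling_eq_density_cellAverage, InfVolFermionState.cellAverage, density_shiftAverage,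
    shift_mix, density_mix, Finset.sum_add_distrib, ← Finset.mul_sum]
  ring

end InfVolFermionState

section Convexity

variable (M : Cell q → FermionInteraction d) (R : ℝ)

/-- **The realised cell fillings form a convex set** (mixtures). [cite: Ruelle1969, §3.4] -/
theorem convex_setOf_periodicStatesAt_nonempty (q : Fin d → ℕ) :
    Convex ℝ {ρ : ℝ | (periodicStatesAt q ρ).Nonempty} := by
  intro ρ₁ h₁ ρ₂ h₂ a b ha hb hab
  obtain ⟨ω₁, hω₁⟩ := h₁
  obtain ⟨ω₂, hω₂⟩ := h₂
  have ha1 : a ≤ 1 := by linarith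
  refine ⟨InfVolFermionState.mix a ha ha1 ω₁ ω₂, hω₁.1.mix hω₂.1 a ha ha1, ?_⟩
  rw [InfVolFermionState.cellFilling_mix, hω₁.2, hω₂.2, show 1 - a = b by linarith, smul_eq_mul, smul_eq_mul]

/-- **CONVEXITY IN THE CELL FILLING, three-point form**: for realised fillings `ρ₁, ρ₂` and `a, b ≥ 0`, `a + b = 1`,
`inf_{aρ₁+bρ₂} e_M ≤ a inf_{ρ₁} e_M + b inf_{ρ₂} e_M` (mix near-minimisers). [cite: Ruelle1969, §3.4] -/
theorem infCellEnergyOn_periodicStatesAt_convex_comb_le {ρ₁ ρ₂ : ℝ} (h₁ : (periodicStatesAt q ρ₁).Nonempty)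
    (h₂ : (periodicStatesAt q ρ₂).Nonempty) {a b : ℝ} (ha : 0 ≤ a) (hb : 0 ≤ b) (hab : a + b = 1) :
    infCellEnergyOn (periodicStatesAt q (a * ρ₁ + b * ρ₂)) M R ≤
      a * infCellEnergyOn (periodicStatesAt q ρ₁) M R + b * infCellEnergyOn (periodicStatesAt q ρ₂) M R := by
  refine le_of_forall_pos_le_add fun ε hε => ?_
  obtain ⟨ω₁, hω₁, he₁⟩ := exists_cellEnergy_lt_of_infCellEnergyOn_lt R M h₁
    (lt_add_of_pos_right (infCellEnergyOn (periodicStatesAt q ρ₁) M R) hε)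
  obtain ⟨ω₂, hω₂, he₂⟩ := exists_cellEnergy_lt_of_infCellEnergyOn_lt R M h₂
    (lt_add_of_pos_right (infCellEnergyOn (periodicStatesAt q ρ₂) M R) hε)
  have ha1 : a ≤ 1 := by linarith
  have hmix : InfVolFermionState.mix a ha ha1 ω₁ ω₂ ∈ periodicStatesAt q (a * ρ₁ + b * ρ₂) := by
    refine ⟨hω₁.1.mix hω₂.1 a ha ha1, ?_⟩
    rw [InfVolFermionState.cellFilling_mix, hω₁.2, hω₂.2, show 1 - a = b by linarith]
  have hle := infCellEnergyOn_le_cellEnergy M R hmix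
  rw [InfVolFermionState.cellEnergy_mix, show 1 - a = b by linarith] at hle
  nlinarith [mul_le_mul_of_nonneg_left he₁.le ha, mul_le_mul_of_nonneg_left he₂.le hb]

/-- **CONVEXITY IN THE CELL FILLING**: on every convex set of realised cell fillings, `ρ̄ ↦ inf_{ρ̄} e_M` is convex.
[cite: Ruelle1969, §3.4] -/
theorem convexOn_infCellEnergyOn_periodicStatesAt {D : Set ℝ} (hD : Convex ℝ D)
    (hne : ∀ ρ ∈ D, (periodicStatesAt q ρ).Nonempty) :
    ConvexOn ℝ D (fun ρ => infCellEnergyOn (periodicStatesAt q ρ) M R) := by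
  refine ⟨hD, fun x hx y hy a b ha hb hab => ?_⟩
  simp only [smul_eq_mul]
  exact infCellEnergyOn_periodicStatesAt_convex_comb_le M R (hne x hx) (hne y hy) ha hb hab

/-! ### §2. Supporting slopes (chemical potentials) at interior realised fillings -/

/-- **A CHEMICAL POTENTIAL AT EVERY INTERIOR REALISED FILLING**: if `ρ̄` is an interior point of the set of realised
cell fillings, there is `μ` (the right derivative) with `inf_{ρ̄} e_M + μ(ρ' − ρ̄) ≤ inf_{ρ'} e_M` for every realised `ρ'`.
[cite: Rockafellar1970, Thm 24.1] -/
theorem exists_supporting_slope_infCellEnergyOn_periodicStatesAt {ρbar : ℝ}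
    (hρ : ρbar ∈ interior {ρ : ℝ | (periodicStatesAt q ρ).Nonempty}) :
    ∃ μ : ℝ, ∀ ρ' : ℝ, (periodicStatesAt q ρ').Nonempty →
      infCellEnergyOn (periodicStatesAt q ρbar) M R + μ * (ρ' - ρbar) ≤ infCellEnergyOn (periodicStatesAt q ρ') M R := by
  have hfc := convexOn_infCellEnergyOn_periodicStatesAt M R (convex_setOf_periodicStatesAt_nonempty q) fun _ h => h
  refine ⟨derivWithin (fun ρ => infCellEnergyOn (periodicStatesAt q ρ) M R) (Set.Ioi ρbar) ρbar, fun x hx => ?_⟩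
  rcases lt_trichotomy x ρbar with hlt | rfl | hgt
  · have h1 := hfc.slope_le_leftDeriv_of_mem_interior hx hρ hlt
    have h2 := hfc.leftDeriv_le_rightDeriv_of_mem_interior hρ
    have h := h1.trans h2
    rw [slope_def_field, div_le_iff₀ (by linarith)] at h
    linarith
  · simp
  · have h := hfc.rightDeriv_le_slope_of_mem_interior hρ (hx : x ∈ {ρ : ℝ | (periodicStatesAt q ρ).Nonempty}) hgt
    rw [slope_def_field, le_div_iff₀ (by linarith)] at h
    linarith

end Convexity

/-! ### §3. The planes of an inequivalent-plane crystal share one chemical potential -/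

section Crystal

variable {ι κ : Type*} [Fintype ι] [Fintype κ] (p : ℕ)

/-- Every filling realised by translation-invariant states of `ℤ^d` (all planes the same) is a realised cell filling of the
stacking superlattice. [cite: ArakiMoriya2003, §11.1 Theorem 11.2] -/
theorem periodicStatesAt_stackPeriods_nonempty_of_exists (hd : 0 < d) {ρ : ℝ}
    (hne : ∃ ω₀ : InfVolFermionState d, ω₀.IsTranslationInvariant ∧ ω₀.density = ρ) :
    (periodicStatesAt (stackPeriods d p) ρ).Nonempty := by
  obtain ⟨ω₀, hω₀, hρ₀⟩ := hne
  have h := periodicStatesAt_stackPeriods_nonempty p hd (σ := fun _ : Fin (p + 1) => ω₀) fun _ => hω₀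
  have hP : (0 : ℝ) < (p : ℝ) + 1 := by positivity
  rwa [Finset.sum_const, Finset.card_univ, Fintype.card_fin, nsmul_eq_mul, Nat.cast_add, Nat.cast_one,
    inv_mul_cancel_left₀ hP.ne', hρ₀] at h

/-- **On `ℤ³` every cell filling in `(0,2)` is realised and interior.** [cite: Ruelle1969, §3.4] -/
theorem Ioo_subset_interior_setOf_periodicStatesAt_nonempty :
    Set.Ioo (0 : ℝ) 2 ⊆ interior {ρ : ℝ | (periodicStatesAt (stackPeriods 2 p) ρ).Nonempty} :=
  interior_maximal (fun _ hρ => periodicStatesAt_stackPeriods_nonempty_of_exists p two_pos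
    (exists_isTranslationInvariant_density_eq hρ.1 hρ.2)) isOpen_Ioo

/-- **ELECTROCHEMICAL EQUILIBRIUM BETWEEN THE PLANES.** For a periodic `ω` within `δ` of the infimum at its own cell
filling, that filling an interior realised one, there is ONE chemical potential `μ` of the crystal such that EVERY plane
marginal is a near grand-canonical ground state of ITS OWN plane model at `μ − ε_j`:
`e_{Φ_j + (ε_j−μ)n}(σ_j) ≤ g_j(ε_j − μ) + (p+1)δ + 2Σ_{j,b}|tz j b|`. [cite: Ruelle1969, §3.4] -/
theorem InfVolFermionState.IsPeriodic.exists_common_chemicalPotential {ω : InfVolFermionState (d + 1)}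
    (hω : ω.IsPeriodic (stackPeriods d p)) (hd : 0 < d) (ε U : Fin (p + 1) → ℝ) {u : ι → Site d}
    (hu : ∀ a, u a ≠ 0) (θ : Fin (p + 1) → ι → ℝ) {w : κ → Site (d + 1)} (hw : ∀ b, w b 0 ≠ 0)
    (tz : Fin (p + 1) → κ → ℝ) {R R' : ℝ} (hR : 1 ≤ R) (hRR' : R ≤ R')
    (huR : ∀ a, u a ∈ thicken ({0} : Finset (Site d)) R) (hwR' : ∀ b, w b ∈ thicken ({0} : Finset (Site (d + 1))) R')
    {δ : ℝ} (hδ : ω.cellEnergy (planeResolvedViews p ε U u θ w tz) R' ≤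
      infCellEnergyOn (periodicStatesAt (stackPeriods d p) (ω.cellFilling (stackPeriods d p)))
        (planeResolvedViews p ε U u θ w tz) R' + δ)
    (hint : ω.cellFilling (stackPeriods d p) ∈ interior {ρ : ℝ | (periodicStatesAt (stackPeriods d p) ρ).Nonempty}) :
    ∃ μ : ℝ, ∀ j : Fin (p + 1),
      (ω.layerMarginal (layerCoset d j)).meanEnergy
          (FermionInteraction.pencil (vectorHoppingModel (U j) u (θ j)) (numberInteraction d) (ε j - μ)) R ≤
        (FermionInteraction.pencil (vectorHoppingModel (U j) u (θ j)) (numberInteraction d) (ε j - μ)).tiGroundEnergyDensity R +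
          (((p : ℝ) + 1) * δ + 2 * ∑ jb : Fin (p + 1) × κ, |tz jb.1 jb.2|) := by
  obtain ⟨μ, hsupp⟩ := exists_supporting_slope_infCellEnergyOn_periodicStatesAt (planeResolvedViews p ε U u θ w tz) R' hint
  have hB := infCellEnergyOn_sub_mu_sub_gc_le_zero_of_supporting p hd ε U hu θ hw tz hR hRR' huR hwR' μ hsupp
  have hbud := hω.gc_budget_of_nearMin p ε U hu θ w tz hR hRR' huR μ hδ
  refine ⟨μ, fun j => ?_⟩
  have hbud' : ω.cellEnergy (planeResolvedViews p (fun j => ε j - μ) U u θ w tz) R' ≤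
      ((p : ℝ) + 1)⁻¹ * ∑ j, (FermionInteraction.pencil (vectorHoppingModel (U j) u (θ j)) (numberInteraction d)
        (ε j - μ)).tiGroundEnergyDensity R + δ := hbud.trans (by linarith)
  exact hω.meanEnergy_layerMarginal_gc_le_of_budget p ε U hu θ (fun b h0 => hw b (by rw [h0]; rfl)) tz hR hRR' huR hwR'
    μ hbud' j

/-- **DOPING-SPLIT BRACKETS AT THE COMMON CHEMICAL POTENTIAL** (no extra slack): under the same hypotheses there is ONE
`μ` such that for every plane `j` and every `h > 0`, with `s_j = ε_j − μ` and `Δ = (p+1)δ + 2Σ|tz|`,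
`(g_j(s_j+h) − g_j(s_j) − Δ)/h ≤ ρ(σ_j) ≤ (g_j(s_j) − g_j(s_j−h) + Δ)/h`. [cite: Ruelle1969, §3.4] -/
theorem InfVolFermionState.IsPeriodic.exists_common_chemicalPotential_layerDensity_brackets {ω : InfVolFermionState (d + 1)}
    (hω : ω.IsPeriodic (stackPeriods d p)) (hd : 0 < d) (ε U : Fin (p + 1) → ℝ) {u : ι → Site d}
    (hu : ∀ a, u a ≠ 0) (θ : Fin (p + 1) → ι → ℝ) {w : κ → Site (d + 1)} (hw : ∀ b, w b 0 ≠ 0)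
    (tz : Fin (p + 1) → κ → ℝ) {R R' : ℝ} (hR : 1 ≤ R) (hRR' : R ≤ R')
    (huR : ∀ a, u a ∈ thicken ({0} : Finset (Site d)) R) (hwR' : ∀ b, w b ∈ thicken ({0} : Finset (Site (d + 1))) R')
    {δ : ℝ} (hδ : ω.cellEnergy (planeResolvedViews p ε U u θ w tz) R' ≤
      infCellEnergyOn (periodicStatesAt (stackPeriods d p) (ω.cellFilling (stackPeriods d p)))
        (planeResolvedViews p ε U u θ w tz) R' + δ)
    (hint : ω.cellFilling (stackPeriods d p) ∈ interior {ρ : ℝ | (periodicStatesAt (stackPeriods d p) ρ).Nonempty}) :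
    ∃ μ : ℝ, ∀ (j : Fin (p + 1)) (h : ℝ), 0 < h →
      ((FermionInteraction.pencil (vectorHoppingModel (U j) u (θ j)) (numberInteraction d) (ε j - μ + h)).tiGroundEnergyDensity R -
          (FermionInteraction.pencil (vectorHoppingModel (U j) u (θ j)) (numberInteraction d) (ε j - μ)).tiGroundEnergyDensity R -
          (((p : ℝ) + 1) * δ + 2 * ∑ jb : Fin (p + 1) × κ, |tz jb.1 jb.2|)) / h ≤
        (ω.layerMarginal (layerCoset d j)).density ∧
      (ω.layerMarginal (layerCoset d j)).density ≤
        ((FermionInteraction.pencil (vectorHoppingModel (U j) u (θ j)) (numberInteraction d) (ε j - μ)).tiGroundEnergyDensity R -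
          (FermionInteraction.pencil (vectorHoppingModel (U j) u (θ j)) (numberInteraction d) (ε j - μ - h)).tiGroundEnergyDensity R +
          (((p : ℝ) + 1) * δ + 2 * ∑ jb : Fin (p + 1) × κ, |tz jb.1 jb.2|)) / h := by
  obtain ⟨μ, hsupp⟩ := exists_supporting_slope_infCellEnergyOn_periodicStatesAt (planeResolvedViews p ε U u θ w tz) R' hint
  exact ⟨μ, fun j h hh => hω.layerDensity_brackets_of_supporting p hd ε U hu θ hw tz hR hRR' huR hwR' μ hδ hsupp j hh⟩

end Crystal

end Literature.MathematicalPhysics.QuantumLattice
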